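import Literature.MathematicalPhysics.QuantumFieldTheory.Balaban1983to89.B9Thm311PosDefOfRegYP335AtLettersY

/-!
# `Balaban1983to89.B9Thm311FormGapOfRegYP335AtLettersY` — T. Bałaban, *Propagators for lattice gauge theories in a background field*, Commun. Math. Phys.
# **99** (1985) 389–434 [Balaban1985BackgroundPropagators], THEOREM 3.11 p. 416 IN QUANTITATIVE FORM: on print's class (3.35), at def-Y's letters of record and
# at every SECTION-CARRYING member above one threshold, `⟨A, Δ_a(U)A⟩ ≥ γ·Σ_b (Lʲ⁽ᵇ⁾η)⁻²‖A(b)‖²` with ONE `γ > 0` (uniform in the member, the volume and `U`)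

statement-level skeleton of published theorems with citation tags; proofs where landed; nothing here is a claim about the Yang–Mills mass gap

THE PRINT.  Thm 3.11 p. 416: «the operators Δ′_a, G′, (Q′G′²Q′\*)⁻¹, Δ_a, G are positive definite»; its proof runs through Thm 3.3 p. 399 (the random-walk
bound (3.42) for `G = Δ_a⁻¹`, profile `C·ℓ(y)²·e^{−δd(y,y′)}`, `ℓ(y) = Lʲ⁽ʸ⁾η` (3.41) p. 397) and (3.105).  A finite-dimensional symmetric operator whose inverse
has the (3.42) majorant and whose quadratic form is bounded below by a small negative multiple of the scale weight ((3.26) p. 395 + (3.69) p. 404) has its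
spectrum in `[R⁻¹, ∞)` — i.e. print's positivity comes WITH A GAP, in the scale-weighted norm.  [4] = Bałaban, *Propagators and renormalization
transformations II*, CMP **96** (1984), Lemma 2.1 (2.60)–(2.61) p. 234, (2.51)–(2.52) p. 232 (coordinates and row sums of majorants).

WHY THIS FILE (cell `pub-ymgap`, node N06, seat `dag-n06-j` = bundle F5 rows 15–17, harness re-seat gen 35; director-ym ruling №375 «R2-A», 2026-08-30).
Row 17 of the N06 certificate is `hΔA : PosDefTr 1 (deltaAY x parSymY parBY (GpY parSymY) U)` on the member's class; this lineage's gen-31 file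
`B9Thm311PosDefOfRegYP335AtLettersY` (✓) derives it at section-carrying members by the road «`S = M_ℓΔ_aM_ℓ` symmetric, `⟨B,SB⟩ ≥ −ε⟨B,B⟩`, `S⁻¹` has a
majorant with row sums `≦ R`, `εR < 1` ⟹ `S > 0`».  The R2-A re-pin of the averaging letter (`Q(U)` becomes a parameter `𝔮` of the v10 record; `Δ_a = Δ + DRD* +
𝔮*a𝔮` is one of the nine re-pinned letters) makes row 17 at the knit letter a NEW face; the cheapest honest road to it is PERTURBATIVE — `Δ_a^𝔮 = Δ_a^Q +
(𝔮*a𝔮 − Q*aQ)` — and a perturbation argument needs the positivity of `Δ_a^Q` WITH A CONSTANT.  THIS FILE extracts that constant from the SAME road: the last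
step «`S > 0`» is replaced by «`S ≥ R⁻¹` as forms», and the sandwich is undone in the scale-weighted norm.  The companion `B9Thm311PosDefAveragingSwap` consumes it.

WHAT IS PROVED (sorry-free; 0 `def`).
* §1 `form_ge_of_isSymmetric_of_eigenvalues_ge` ∕ ★ `form_ge_of_isSymmetric_of_form_ge_of_eigen_abs_ge` (a finite-dimensional real inner product space:
  symmetric `T`, form `≥ −ε`, every eigenvalue of modulus `≥ K⁻¹`, `εK < 1` ⟹ `⟨v,Tv⟩ ≥ K⁻¹‖v‖²` — spectral theorem, Mathlib's `eigenvectorBasis` and the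
  tree's `Literature.Analysis.InnerProduct.inner_apply_self_eq_sum_eigenvalues` BY NAME); ★★ `form_ge_of_isSymmTr_of_form_ge_of_eigen_abs_ge` (the same in
  def-Y's genuine currency `trIP w ∕ IsSymmTr w`, through this lineage's orthonormal chart `realify311`).
* §2 ★ `form_ge_weighted_of_sandwich`: a form gap `γ` of the sandwich `M_rΔM_r` at unit weight IS the gap `⟨A,ΔA⟩₁ ≥ γ·Σ_s r(s)⁻²·HS(A(s))` of `Δ`.
* §3 ★★★ `formGap_deltaAY_of_regYP335_section`: `∃ M₁ a₁ γ > 0`, for every member `x` with `β` onto, `M₁ ≦ M`, `0 < α₀`, `M·α₀ ≦ a₁`, every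
  `U ∈ (bg9YP … x).Reg335 c₃₅ α₀` and EVERY `A`: `γ·Σ_b c_f²(L^{lev b})⁻²‖A(b)‖²_{HS} ≤ ⟨A, Δ_a(U)A⟩₁` (the weight is the one of
  `B9Thm311HessianWeightedLowerBoundY.trIP_deltaAY_ge_neg_weighted`, `= ℓ(b)⁻²`; `γ = R⁻¹` with the gen-31 file's `R`); ★★ `formGap_deltaAY_of_regYP335_section_one`
  (the unweighted corollary `γ·⟨A,A⟩₁ ≤ ⟨A,Δ_a(U)A⟩₁`, since `ℓ(b) ≤ 1`); §4 the `SCMemberY` ∕ R-class shapes by name.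
HONEST SCOPE.  A re-assembly of LANDED theorems (lit-balaban's Thm 3.3 block `isUnit_deltaAY_and_eBlock_of_regYP335_section`, this lineage's (3.69) lower bound and
spectral engine) with a stronger last line; section-carrying members only (inner-corner members: see the gen-33∕34 notes of this seat — other lanes); NOT a node
discharge; count-neutral; nothing continuum ∕ OS ∕ mass gap ∕ Clay.  No `sorry`, no `axiom`, no `instance`, no `notation`, no `def`.
-/

noncomputable section

namespace Literature.MathematicalPhysics.QuantumFieldTheory.Balaban1983to89.B9Thm311FormGapOfRegYP335AtLettersY

open Literature.MathematicalPhysics.QuantumFieldTheory.Balaban1983to89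
open B6RandomWalk B9Thm311ReadingCoords B9Thm39ReadingCoords B9Thm39ReadingAtLetters Node00
open B6KLevelCensusIndexV1 B6Ineq2142KLevelV1 B6GlobalChartV1 B9PinMembersKLevelV1 B9PinGeometryKLevelV1 B9GeoNormsKLevelV1
  B9BackgroundsKLevelV1 B9BackgroundsKLevelV1P B9Thm34Ext
open B9Thm311PosDefViaSpectralGap B9Thm311HessianWeightedLowerBoundY B9Thm311EigenBoundOfMajorant B9Thm310DeltaAIsUnitOfRegYP335AtLettersY
open B9Thm311PosDefOfRegYP335AtLettersY
open Literature.MathematicalPhysics.QuantumFieldTheory.Balaban1983to89.B9Thm37Sum (mulOp mulOp_apply)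
open Literature.MathematicalPhysics.QuantumFieldTheory.Balaban1983to89.B9Thm37CubeCoverCommutators (cutMulY cutMulY_apply)
open Literature.MathematicalPhysics.QuantumFieldTheory.Balaban1983to89.B9Eq352DivFormLetters (conj conj_apply coordEquiv)
open Literature.MathematicalPhysics.QuantumFieldTheory.Balaban1983to89.B9CubeLettersInvReadDictBMajorants (hasMajorant_conj_G_of_eBlockInvB)
open Literature.MathematicalPhysics.QuantumFieldTheory.Balaban1983to89.B9GeoLemma21KLevelV1 (rowSum_geo9K_core transferL_geo9K geo9K_dist_comm geo9K_dist_nonneg' geo9K_len_pos geo9K_one_le_L)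
open Literature.MathematicalPhysics.QuantumFieldTheory.Balaban1983to89.B6Cor28 (TransferL)
open Literature.MathematicalPhysics.QuantumFieldTheory.Balaban1983to89.B6RandomWalk (HasMajorant hasMajorant_mono)
open Literature.MathematicalPhysics.QuantumFieldTheory.Balaban1983to89.B9Thm311PosViaLocalInversesY (deltaAY_parSymY_isSymmTr)
open Literature.MathematicalPhysics.QuantumFieldTheory.Balaban1983to89.B9Ineq369CurvatureSmallAtLettersY (hs_nonneg trIP_one_self_eq)
open Literature.MathematicalPhysics.QuantumFieldTheory.Balaban1983to89.B9Thm39OneCubeReadingAtLettersY (geo9Y_M_nonneg)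
open Literature.MathematicalPhysics.QuantumFieldTheory.Balaban1983to89.B9SectBCodedClassR (bg9YC extraYPb)
open Literature.MathematicalPhysics.QuantumFieldTheory.Balaban1983to89.B9FromB6 (EBlock)
open Literature.MathematicalPhysics.QuantumFieldTheory.Balaban1983to89.B9CubeLettersInvReadings (kernelFamilyBInv)
open Literature.MathematicalPhysics.QuantumFieldTheory.Balaban1983to89.B9SectionCarryingMembersV1 (SCMemberY)
open scoped InnerProductSpace

/-! ## §1 The spectral-gap engine with a constant: abstract, then in def-Y's genuine currency -/

section Abstract

variable {V : Type*} [NormedAddCommGroup V] [InnerProductSpace ℝ V] [FiniteDimensional ℝ V] {T : V →ₗ[ℝ] V}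

/-- **a symmetric operator all of whose eigenvalues (at eigenvectors) are `≥ γ` is `≥ γ` as a form**: `⟨v, Tv⟩ ≥ γ‖v‖²` (spectral theorem: expand in Mathlib's
orthonormal eigenvector basis; Rayleigh expansion by name from `Literature.Analysis.InnerProduct`). [cite: Balaban1985BackgroundPropagators, Thm 3.11 p.416 («symmetric … positive definite»), bookkeeping] -/
theorem form_ge_of_isSymmetric_of_eigenvalues_ge (hT : T.IsSymmetric) {γ : ℝ} (hge : ∀ (μ : ℝ) (v : V), v ≠ 0 → T v = μ • v → γ ≤ μ) (x : V) :
    γ * ‖x‖ ^ 2 ≤ ⟪x, T x⟫_ℝ := by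
  obtain ⟨d, hd⟩ : ∃ d, Module.finrank ℝ V = d := ⟨_, rfl⟩
  have hexp := Literature.Analysis.InnerProduct.inner_apply_self_eq_sum_eigenvalues hT hd x
  have hlam : ∀ i, γ ≤ hT.eigenvalues hd i := by
    intro i
    refine hge _ _ ((hT.eigenvectorBasis hd).orthonormal.ne_zero i) ?_
    have h := hT.apply_eigenvectorBasis hd i
    simpa only [RCLike.ofReal_real_eq_id, id_eq] using h
  have hpar : ∑ i, ⟪hT.eigenvectorBasis hd i, x⟫_ℝ ^ 2 = ‖x‖ ^ 2 := (hT.eigenvectorBasis hd).sum_sq_inner_right x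
  rw [real_inner_comm, hexp, ← hpar, Finset.mul_sum]
  exact Finset.sum_le_sum fun i _ => mul_le_mul_of_nonneg_right (hlam i) (sq_nonneg _)

/-- ★ **THE SPECTRAL-GAP ENGINE WITH A CONSTANT**: a symmetric `T` with `⟨v, Tv⟩ ≥ −ε‖v‖²` whose eigenvalues all have modulus `≥ K⁻¹`, `0 < K`, `εK < 1`,
satisfies `⟨v, Tv⟩ ≥ K⁻¹‖v‖²` (no eigenvalue sits in `[−ε, K⁻¹)`). [cite: Balaban1985BackgroundPropagators, Thm 3.11 p.416; Thm 3.3 p.399] -/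
theorem form_ge_of_isSymmetric_of_form_ge_of_eigen_abs_ge (hT : T.IsSymmetric) {ε K : ℝ} (hK : 0 < K) (hεK : ε * K < 1)
    (hform : ∀ v : V, -ε * ‖v‖ ^ 2 ≤ ⟪v, T v⟫_ℝ) (heig : ∀ (μ : ℝ) (v : V), v ≠ 0 → T v = μ • v → K⁻¹ ≤ |μ|) (x : V) :
    K⁻¹ * ‖x‖ ^ 2 ≤ ⟪x, T x⟫_ℝ := by
  refine form_ge_of_isSymmetric_of_eigenvalues_ge hT (fun μ v hv hTv => ?_) x
  have hμ : 0 < μ := by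
    refine eigenvalue_pos_of_form_ge_of_abs_ge hK hεK ?_ (heig μ v hv hTv)
    have h := hform v
    rw [hTv, real_inner_smul_right, real_inner_self_eq_norm_sq] at h
    have hn : 0 < ‖v‖ ^ 2 := by positivity
    nlinarith
  have h := heig μ v hv hTv
  rwa [abs_of_pos hμ] at h

end Abstract

section Genuine

variable {S n : Type} [Fintype S] [Fintype n]
variable {w : S → ℝ}

/-- ★★ **THE ENGINE WITH A CONSTANT AT def-Y's LETTERS**: for a `ℂ`-linear operator `T` on `S → M_n(ℂ)`, symmetric for the weighted trace pairing `⟨·,·⟩_w`,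
with `⟨Φ, TΦ⟩_w ≥ −ε⟨Φ, Φ⟩_w` and every real eigenvalue of modulus `≥ K⁻¹` (`0 < K`, `εK < 1`): `⟨Φ, TΦ⟩_w ≥ K⁻¹⟨Φ, Φ⟩_w` for every `Φ`.
[cite: Balaban1985BackgroundPropagators, Thm 3.11 p.416; Thm 3.3 p.399] -/
theorem form_ge_of_isSymmTr_of_form_ge_of_eigen_abs_ge (hw : ∀ s, 0 < w s) (T : (S → Matrix n n ℂ) →ₗ[ℂ] (S → Matrix n n ℂ)) (hT : IsSymmTr w T)
    {ε K : ℝ} (hK : 0 < K) (hεK : ε * K < 1) (hform : ∀ Φ, -ε * trIP w Φ Φ ≤ trIP w Φ (T Φ))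
    (heig : ∀ (μ : ℝ) (Φ : S → Matrix n n ℂ), Φ ≠ 0 → T Φ = (μ : ℂ) • Φ → K⁻¹ ≤ |μ|) (Φ : S → Matrix n n ℂ) :
    K⁻¹ * trIP w Φ Φ ≤ trIP w Φ (T Φ) := by
  have hsymm : (conj311 (realify311 w hw) (realify311 w hw) T).IsSymmetric := by
    intro u v
    exact (symm_conj311_realify311_iff (hw := hw) T).2 hT u v
  have hformV : ∀ v, -ε * ‖v‖ ^ 2 ≤ ⟪v, conj311 (realify311 w hw) (realify311 w hw) T v⟫_ℝ := by
    intro v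
    have h := hform ((realify311 w hw).symm v)
    have e1 : ⟪v, conj311 (realify311 w hw) (realify311 w hw) T v⟫_ℝ = trIP w ((realify311 w hw).symm v) (T ((realify311 w hw).symm v)) := by
      rw [conj311_apply, ← inner_realify311 (hw := hw), LinearEquiv.apply_symm_apply]
    have e2 : ‖v‖ ^ 2 = trIP w ((realify311 w hw).symm v) ((realify311 w hw).symm v) := by
      rw [← norm_sq_realify311 (hw := hw), LinearEquiv.apply_symm_apply]
    rw [e1, e2]; exact h
  have heigV : ∀ (μ : ℝ) (v : _), v ≠ 0 → conj311 (realify311 w hw) (realify311 w hw) T v = μ • v → K⁻¹ ≤ |μ| := by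
    intro μ v hv hTv
    have hΦ : (realify311 w hw).symm v ≠ 0 := fun h0 => hv (by simpa using congrArg (realify311 w hw) h0)
    refine heig μ _ hΦ ?_
    have h1 : realify311 w hw (T ((realify311 w hw).symm v)) = μ • v := by rw [← conj311_apply]; exact hTv
    have h2 : T ((realify311 w hw).symm v) = (realify311 w hw).symm (μ • v) := by
      rw [← h1, LinearEquiv.symm_apply_apply]
    rw [h2, LinearEquiv.map_smul, Complex.coe_smul]
  have h := form_ge_of_isSymmetric_of_form_ge_of_eigen_abs_ge hsymm hK hεK hformV heigV (realify311 w hw Φ)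
  rw [norm_sq_realify311 (hw := hw), conj311_apply, LinearEquiv.symm_apply_apply, inner_realify311 (hw := hw)] at h
  exact h

end Genuine

/-! ## §2 Undoing the scale sandwich in the scale-weighted norm -/

section Sandwich

open scoped Matrix.Norms.L2Operator

variable {S : Type} [Fintype S] {N : ℕ}

/-- ★ **A FORM GAP OF `M_rΔM_r` IS A WEIGHTED FORM GAP OF `Δ`**: if `⟨B, (M_rΔM_r)B⟩₁ ≥ γ⟨B, B⟩₁` for all `B` and `r` vanishes nowhere, then
`⟨A, ΔA⟩₁ ≥ γ·Σ_s r(s)⁻²·HS(A(s))` for all `A` (put `B = M_{r⁻¹}A`). [cite: Balaban1985BackgroundPropagators, (3.41) p.397 (weights), Thm 3.11 p.416, bookkeeping] -/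
theorem form_ge_weighted_of_sandwich (r : S → ℝ) (hr : ∀ s, r s ≠ 0)
    {Δ : (S → Matrix (Fin N) (Fin N) ℂ) →ₗ[ℂ] (S → Matrix (Fin N) (Fin N) ℂ)} {γ : ℝ}
    (h : ∀ B, γ * trIP (fun _ => (1 : ℝ)) B B ≤ trIP (fun _ => (1 : ℝ)) B ((cutMulY r ∘ₗ Δ ∘ₗ cutMulY r) B))
    (A : S → Matrix (Fin N) (Fin N) ℂ) :
    γ * ∑ s, ((r s)⁻¹) ^ 2 * ∑ a, ∑ c, ‖A s a c‖ ^ 2 ≤ trIP (fun _ => (1 : ℝ)) A (Δ A) := by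
  have hA : cutMulY r (cutMulY (fun s => (r s)⁻¹) A) = A := by
    rw [cutMulY_cutMulY_fun]
    have : (fun s => r s * (r s)⁻¹) = fun _ => (1 : ℝ) := funext fun s => mul_inv_cancel₀ (hr s)
    rw [this, cutMulY_constOne]
  have hB := h (cutMulY (fun s => (r s)⁻¹) A)
  have hBB : trIP (fun _ => (1 : ℝ)) (cutMulY (fun s => (r s)⁻¹) A) (cutMulY (fun s => (r s)⁻¹) A)
      = ∑ s, ((r s)⁻¹) ^ 2 * ∑ a, ∑ c, ‖A s a c‖ ^ 2 := by
    rw [trIP_one_self_eq]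
    refine Finset.sum_congr rfl fun s _ => ?_
    rw [hs_cutMulY]
  have hBS : trIP (fun _ => (1 : ℝ)) (cutMulY (fun s => (r s)⁻¹) A) ((cutMulY r ∘ₗ Δ ∘ₗ cutMulY r) (cutMulY (fun s => (r s)⁻¹) A))
      = trIP (fun _ => (1 : ℝ)) A (Δ A) := by
    rw [LinearMap.comp_apply, LinearMap.comp_apply, hA, ← trIP_cutMulY_left, hA]
  rw [hBB, hBS] at hB
  exact hB

end Sandwich

/-! ## §3 ★★★ Row 17 with a constant: the scale-weighted coercivity of `Δ_a(U)` on print's class at section-carrying members -/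

section Record

open scoped Matrix.Norms.L2Operator
open B7Prop2SpecialUnitary

variable {N : ℕ} (θ : Stage3Params) (Mstar : ℕ)

/-- ★★★ **THEOREM 3.11 WITH A GAP, FOR `Δ_a` ON PRINT's CLASS (3.35), AT def-Y's LETTERS OF RECORD, FOR EVERY SECTION-CARRYING MEMBER ABOVE ONE THRESHOLD**:
there are `M₁, a₁, γ > 0` such that for every member `x` whose carrier-block map `β` is onto, `M₁ ≦ M`, every `α₀ > 0` with `M·α₀ ≦ a₁`, every
`SU(N)`-valued `U ∈ (bg9YP … x).Reg335 c₃₅ α₀` and EVERY bond function `A`: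
`γ · Σ_b c_f²·(L^{lev b})⁻²·‖A(b)‖²_{HS} ≤ ⟨A, Δ_a(U) A⟩₁` — the scale weight `c_f²(L^{lev b})⁻² = ℓ(b)⁻²` of (3.41).
ROAD: the gen-31 road verbatim (`S = M_ℓΔ_aM_ℓ` symmetric, `⟨B,SB⟩₁ ≥ −ε⟨B,B⟩₁` by (3.26)+(3.69), `S⁻¹ = M_{ℓ⁻¹}GM_{ℓ⁻¹}` with a (2.51) majorant of row sums
`≦ R` by Thm 3.3 + (2.60)–(2.61), `εR < 1`), closed by §1 («`S ≥ R⁻¹`») and §2 (un-sandwich); `γ = R⁻¹`.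
[cite: Balaban1985BackgroundPropagators, Thm 3.11 p.416; Thm 3.3 p.399; (3.26) p.395; (3.41) p.397; (3.69) p.404; Balaban1984PropagatorsII, Lemma 2.1 (2.60)–(2.61) p.234, (2.51)–(2.52) p.232] -/
theorem formGap_deltaAY_of_regYP335_section (hN : 1 ≤ N) :
    ∃ M₁ a₁ γ : ℝ, 0 < M₁ ∧ 0 < a₁ ∧ 0 < γ ∧
    ∀ (x : MemberY θ.d₆ θ.ℓ₆ θ.hd' θ.hL' θ.b₀ θ.b₁ Mstar), Function.Surjective (β x.hN x.D x.hk) → M₁ ≤ (geo9Y x).M →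
      ∀ α₀ : ℝ, 0 < α₀ → (geo9Y x).M * α₀ ≤ a₁ →
      ∀ U : CfgY (Matrix (Fin N) (Fin N) ℂ) x.toKIdx,
        (bg9YP (Matrix (Fin N) (Fin N) ℂ) (specialUnitaryUnits (Fin N)) x).Reg335 c35Y α₀ U →
        ∀ A : FBondY x.toKIdx → Matrix (Fin N) (Fin N) ℂ,
          γ * ∑ b, (x.toKIdx.cf ^ 2 * ((((θ.ℓ₆ : ℝ) + 1) ^ levV1 x.toKIdx b.src)⁻¹) ^ 2) * ∑ a, ∑ c, ‖A b a c‖ ^ 2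
            ≤ trIP (fun _ => (1 : ℝ)) A (deltaAY x.toKIdx (parSymY x.toKIdx) (parBY x.toKIdx) (GpY x.toKIdx (parSymY x.toKIdx)) U A) := by
  classical
  haveI : Nonempty (Fin N) := ⟨⟨0, hN⟩⟩
  haveI instK : ∀ i' : KIdx θ.d₆ θ.ℓ₆ θ.hd' θ.hL' θ.b₀ θ.b₁, Fintype (geo9K i').Site := fun i' => (kGeoU i').fin
  -- Theorem 3.3's (3.42) block of `G = Δ_a⁻¹` and `IsUnit Δ_a` on the class (lit-balaban's ASM2 chain, this seat's gen-31 assembly)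
  obtain ⟨M₂, a₂, δA, KA, hM₂, ha₂, hδA, hKA, H⟩ := isUnit_deltaAY_and_eBlock_of_regYP335_section (N := N) θ Mstar hN
  -- [4] Lemma 2.1 (2.61): uniform row sums at rate `δ_A∕2`
  obtain ⟨ML, Crow, hrowC⟩ := rowSum_geo9K_core (d := θ.d₆) (ℓ := θ.ℓ₆) (hd := θ.hd') (hL := θ.hL') (b₀ := θ.b₀) (b₁ := θ.b₁)
    (κ := δA / 2) (half_pos hδA)
  -- constants
  set L : ℝ := (θ.ℓ₆ : ℝ) + 1 with hLdef
  have hL1 : 1 ≤ L := by rw [hLdef]; have : (0 : ℝ) ≤ θ.ℓ₆ := Nat.cast_nonneg _; linarith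
  have hL0 : 0 < L := lt_of_lt_of_le one_pos hL1
  have hMb : 0 ≤ coordBound39 (basis39 (Matrix (Fin N) (Fin N) ℂ)) := norm_nonneg _
  set C₀ : ℝ := coordBound39 (basis39 (Matrix (Fin N) (Fin N) ℂ)) * (∑ j, ‖basis39 (Matrix (Fin N) (Fin N) ℂ) j‖) * KA with hC₀
  have hC₀0 : 0 ≤ C₀ := mul_nonneg (mul_nonneg hMb (Finset.sum_nonneg fun _ _ => norm_nonneg _)) hKA
  set R : ℝ := max (C₀ * L ^ |(1 : ℝ)| * Crow) 1 with hRdef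
  have hR1 : 1 ≤ R := le_max_right _ _
  have hR0 : 0 < R := lt_of_lt_of_le one_pos hR1
  have he4 : 0 < Real.exp 4 := Real.exp_pos _
  set εc : ℝ := 12 * ((θ.d₆ : ℝ) + 1) * L ^ 2 * (40 * Real.exp 4 * L ^ 3) with hεc
  have hεc0 : 0 < εc := by positivity
  set Mtr : ℝ := |(1 : ℝ)| * Real.log L / (δA / 2 * (2 * L ^ 2 - 1)) with hMtr
  set abud : ℝ := min a₂ (min (1 / (10 * L)) (min (1 / (40 * Real.exp 4 * L ^ 3)) (1 / (2 * εc * R)))) with habud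
  have habud0 : 0 < abud := by positivity
  refine ⟨max M₂ (max ML (max Mtr 1)), abud, R⁻¹, lt_of_lt_of_le hM₂ (le_max_left _ _), habud0, inv_pos.2 hR0, ?_⟩
  intro x hsurj hM α₀ hα ha U hU A
  have hG : specialUnitaryUnits (Fin N) ≤ B7Prop2Explicit.unitaryUnits (Matrix (Fin N) (Fin N) ℂ) := specialUnitaryUnits_le_unitaryUnits
  have hUG : ∀ μ z, U μ z ∈ specialUnitaryUnits (Fin N) := hU.1.1
  -- the member's letters
  have hLK : (kGeo x.toKIdx).L = L := by rw [hLdef]; show (((θ.ℓ₆ + 1 : ℕ) : ℝ)) = _; push_cast; ring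
  have hLK9 : (geo9K x.toKIdx).L = L := hLK
  have hMK' : (kGeo x.toKIdx).M = (geo9Y x).M := rfl
  have hMK9 : (geo9K x.toKIdx).M = (geo9Y x).M := rfl
  have hMα : 0 ≤ (geo9Y x).M * α₀ := mul_nonneg (geo9Y_M_nonneg θ Mstar x) hα.le
  have ha2 : (geo9Y x).M * α₀ ≤ a₂ := ha.trans (min_le_left _ _)
  have ha3 : (geo9Y x).M * α₀ ≤ 1 / (10 * L) := ha.trans ((min_le_right _ _).trans (min_le_left _ _))
  have ha4 : (geo9Y x).M * α₀ ≤ 1 / (40 * Real.exp 4 * L ^ 3) :=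
    ha.trans ((min_le_right _ _).trans ((min_le_right _ _).trans (min_le_left _ _)))
  have ha5 : (geo9Y x).M * α₀ ≤ 1 / (2 * εc * R) :=
    ha.trans ((min_le_right _ _).trans ((min_le_right _ _).trans (min_le_right _ _)))
  -- Theorem 3.3 at the member
  obtain ⟨hunit, hE⟩ := H x hsurj ((le_max_left _ _).trans hM) α₀ hα ha2 U hU
  have hEB := hE (B := bg9YP (Matrix (Fin N) (Fin N) ℂ) (specialUnitaryUnits (Fin N)) x) (fun V => V) (parBY x.toKIdx) U rfl
  -- a section of `β` and the weight letter `ℓ(b) = ℓ(ιB(blkV1 b))`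
  obtain ⟨ιB, hι⟩ : ∃ ιB : BlkY x.toKIdx → IBondY x.toKIdx, ∀ s, β x.hN x.D x.hk (ιB s) = s :=
    ⟨fun s => (hsurj s).choose, fun s => (hsurj s).choose_spec⟩
  obtain ⟨wl, hwl⟩ : ∃ wl : FBondY x.toKIdx → ℝ, ∀ b', wl b' = (geo9K x.toKIdx).len (ιB (blkV1 x.hN x.D b')) := ⟨_, fun _ => rfl⟩
  have hwl0 : ∀ b', 0 < wl b' := fun b' => by rw [hwl]; exact geo9K_len_pos x.toKIdx _
  have hwl1 : ∀ b', wl b' ≠ 0 := fun b' => (hwl0 b').ne'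
  -- `S⁻¹ := M_{ℓ⁻¹} G M_{ℓ⁻¹}` is a left inverse of `S := M_ℓ Δ_a M_ℓ`
  have hGΔ : ∀ Φ, GAY x.toKIdx (parSymY x.toKIdx) (parBY x.toKIdx) (GpY x.toKIdx (parSymY x.toKIdx)) U
      (deltaAY x.toKIdx (parSymY x.toKIdx) (parBY x.toKIdx) (GpY x.toKIdx (parSymY x.toKIdx)) U Φ) = Φ := by
    intro Φ
    rw [← Module.End.mul_apply, GAY_mul_deltaAY x.toKIdx hunit, Module.End.one_apply]
  have hinv := sandwich_leftInv (r := wl) hwl1 hGΔ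
  -- (ii) the (2.51) majorant of `conj b S⁻¹` (Thm 3.3's block read by lit-balaban's dictionary, diagonal sandwich) and its row sums
  have hmajG := hasMajorant_conj_G_of_eBlockInvB x.toKIdx (basis39 (Matrix (Fin N) (Fin N) ℂ)) (Rr := 0) (Hp := True)
    (B := bg9YP (Matrix (Fin N) (Fin N) ℂ) (specialUnitaryUnits (Fin N)) x) (U₁ := U) (fun V => V)
    (GAY x.toKIdx (parSymY x.toKIdx) (parBY x.toKIdx) (GpY x.toKIdx (parSymY x.toKIdx))) (parBY x.toKIdx) hEB hKA ιB hι hMb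
    (fun v j => abs_repr_le (basis39 (Matrix (Fin N) (Fin N) ℂ)) v j)
    ((GAY x.toKIdx (parSymY x.toKIdx) (parBY x.toKIdx) (GpY x.toKIdx (parSymY x.toKIdx)) U).restrictScalars ℝ)
    (fun Λ => LinearMap.restrictScalars_apply ℝ _ Λ)
  have hmajS := hasMajorant_conj_sandwich (basis39 (Matrix (Fin N) (Fin N) ℂ)) (g := toB6 (geo9K x.toKIdx) 0 True)
    (fun b' : FBondY x.toKIdx => ιB (blkV1 x.hN x.D b')) (geo9K x.toKIdx).len (geo9K_len_pos x.toKIdx)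
    (r := fun b' => (wl b')⁻¹) (fun b' => by rw [hwl, abs_of_pos (inv_pos.2 (geo9K_len_pos x.toKIdx _))]) hmajG
  have hML : ML ≤ (geo9K x.toKIdx).M := by rw [hMK9]; exact ((le_max_left _ _).trans (le_max_right _ _)).trans hM
  have hMtr' : Mtr ≤ (geo9Y x).M := ((le_max_left _ _).trans ((le_max_right _ _).trans (le_max_right _ _))).trans hM
  have hMlog : |(1 : ℝ)| * Real.log (geo9K x.toKIdx).L ≤ δA / 2 * (2 * ((θ.ℓ₆ : ℝ) + 1) ^ 2 - 1) * (geo9K x.toKIdx).M := by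
    have hden : 0 < δA / 2 * (2 * L ^ 2 - 1) := by
      have : 1 ≤ L ^ 2 := one_le_pow₀ hL1
      have : 0 < 2 * L ^ 2 - 1 := by linarith
      positivity
    have h := (div_le_iff₀ hden).1 hMtr'
    rw [hLK9, hMK9, ← hLdef]
    linarith
  have hrowS : ∀ a, ∑ a', C₀ * (geo9K x.toKIdx).len a * ((geo9K x.toKIdx).len a')⁻¹ * Real.exp (-(δA * (geo9K x.toKIdx).dist a a')) ≤ R := by
    intro a
    refine (rowSum_weighted_le x.toKIdx hδA hC₀0 (hrowC x.toKIdx hML) hMlog a).trans ?_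
    rw [hRdef, hLK9]
    exact le_max_left _ _
  -- hence every real eigenvalue `λ` of `S` has `|λ| ≥ R⁻¹`
  have heig := inv_le_abs_eigen_of_leftInv (basis39 (Matrix (Fin N) (Fin N) ℂ)) (g := toB6 (geo9K x.toKIdx) 0 True)
    (fun p : FBondY x.toKIdx × κ39 (Matrix (Fin N) (Fin N) ℂ) => ιB (blkV1 x.hN x.D p.1)) hinv hmajS hR0 hrowS
  -- (i) the form bound: the class's plaquette window and (3.26) + (3.69) in scale-weighted form
  have hK1 : 10 * (kGeo x.toKIdx).L * ((kGeo x.toKIdx).M * α₀) ≤ 1 := by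
    rw [hLK, hMK']
    have := (le_div_iff₀ (by positivity : (0 : ℝ) < 10 * L)).1 ha3
    linarith
  obtain ⟨δh, hδh⟩ : ∃ δh : ℝ, δh = 40 * Real.exp 4 * L ^ 3 * ((geo9Y x).M * α₀) := ⟨_, rfl⟩
  have hδh0 : 0 ≤ δh := by rw [hδh]; positivity
  have hδh1 : δh ≤ 1 := by
    have := (le_div_iff₀ (by positivity : (0 : ℝ) < 40 * Real.exp 4 * L ^ 3)).1 ha4
    rw [hδh]; linarith
  have hplaq : ∀ p : PlaqY x.toKIdx, ‖((holY x.toKIdx U p : (Matrix (Fin N) (Fin N) ℂ)ˣ) : Matrix (Fin N) (Fin N) ℂ) - 1‖ ≤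
      δh * ((((θ.ℓ₆ : ℝ) + 1) ^ levV1 x.toKIdx p.src)⁻¹) ^ 2 := by
    intro p
    have h := norm_holY_sub_one_le_window_of_reg335P x.toKIdx U (by norm_num [c35Y]) (by rw [hMK']; exact hMα) hK1 hU.1 p
    rw [hLK, hMK'] at h
    rw [hδh]
    exact h
  have hform := form_sandwich_ge (ε := 12 * ((θ.d₆ : ℝ) + 1) * ((θ.ℓ₆ : ℝ) + 1) ^ 2 * δh) wl
    (fun b' : FBondY x.toKIdx => x.toKIdx.cf ^ 2 * ((((θ.ℓ₆ : ℝ) + 1) ^ levV1 x.toKIdx b'.src)⁻¹) ^ 2)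
    (fun b' => by rw [hwl]; exact len_sq_mul_weight x.toKIdx ιB hι b') (trIP_deltaAY_ge_neg_weighted x.toKIdx hG hUG hδh0 hδh1 hplaq)
  -- symmetry of `S`
  have hsymm := isSymmTr_sandwich wl (deltaAY_parSymY_isSymmTr x.toKIdx hG hUG)
  -- (iii) the gap `ε·R < 1`
  have hεK : 12 * ((θ.d₆ : ℝ) + 1) * ((θ.ℓ₆ : ℝ) + 1) ^ 2 * δh * R < 1 := by
    have h0 : 12 * ((θ.d₆ : ℝ) + 1) * ((θ.ℓ₆ : ℝ) + 1) ^ 2 * δh = εc * ((geo9Y x).M * α₀) := by rw [hδh, hεc, hLdef]; ring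
    rw [h0]
    have h2 : εc * ((geo9Y x).M * α₀) * R ≤ εc * (1 / (2 * εc * R)) * R :=
      mul_le_mul_of_nonneg_right (mul_le_mul_of_nonneg_left ha5 hεc0.le) hR0.le
    have h3 : εc * (1 / (2 * εc * R)) * R = 1 / 2 := by field_simp
    linarith
  -- §1: `S ≥ R⁻¹` as forms; §2: un-sandwich in the weight `wl⁻² = c_f²(L^{lev})⁻²`
  have hgap := form_ge_of_isSymmTr_of_form_ge_of_eigen_abs_ge (w := fun _ => (1 : ℝ)) (fun _ => one_pos) _ hsymm hR0 hεK hform heig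
  have hA := form_ge_weighted_of_sandwich wl hwl1 hgap A
  have hwt : ∀ b' : FBondY x.toKIdx, ((wl b')⁻¹) ^ 2 = x.toKIdx.cf ^ 2 * ((((θ.ℓ₆ : ℝ) + 1) ^ levV1 x.toKIdx b'.src)⁻¹) ^ 2 := by
    intro b'
    have h1 := len_sq_mul_weight x.toKIdx ιB hι b'
    rw [← hwl] at h1
    rw [inv_pow, ← one_div, div_eq_iff (pow_ne_zero 2 (hwl1 b')), mul_comm]
    exact h1.symm
  simp only [hwt] at hA
  exact hA

/-- ★★ **THE UNWEIGHTED COROLLARY**: with the same `M₁, a₁, γ`, `γ·⟨A, A⟩₁ ≤ ⟨A, Δ_a(U)A⟩₁` — because the scale weight `c_f²(L^{lev b})⁻² = (L^{k − lev b})²`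
is `≥ 1` (`lev b ≤ k`, `c_f = Lᵏ` at a member: `levV1_le`, `MemberY.hcfk`). [cite: Balaban1985BackgroundPropagators, Thm 3.11 p.416, (3.41) p.397 («Lʲη ≤ 1»)] -/
theorem formGap_deltaAY_of_regYP335_section_one (hN : 1 ≤ N) :
    ∃ M₁ a₁ γ : ℝ, 0 < M₁ ∧ 0 < a₁ ∧ 0 < γ ∧
    ∀ (x : MemberY θ.d₆ θ.ℓ₆ θ.hd' θ.hL' θ.b₀ θ.b₁ Mstar), Function.Surjective (β x.hN x.D x.hk) → M₁ ≤ (geo9Y x).M →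
      ∀ α₀ : ℝ, 0 < α₀ → (geo9Y x).M * α₀ ≤ a₁ →
      ∀ U : CfgY (Matrix (Fin N) (Fin N) ℂ) x.toKIdx,
        (bg9YP (Matrix (Fin N) (Fin N) ℂ) (specialUnitaryUnits (Fin N)) x).Reg335 c35Y α₀ U →
        ∀ A : FBondY x.toKIdx → Matrix (Fin N) (Fin N) ℂ,
          γ * trIP (fun _ => (1 : ℝ)) A A
            ≤ trIP (fun _ => (1 : ℝ)) A (deltaAY x.toKIdx (parSymY x.toKIdx) (parBY x.toKIdx) (GpY x.toKIdx (parSymY x.toKIdx)) U A) := by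
  obtain ⟨M₁, a₁, γ, hM₁, ha₁, hγ, h⟩ := formGap_deltaAY_of_regYP335_section (N := N) θ Mstar hN
  refine ⟨M₁, a₁, γ, hM₁, ha₁, hγ, fun x hsurj hM α₀ hα ha U hU A => le_trans ?_ (h x hsurj hM α₀ hα ha U hU A)⟩
  rw [trIP_one_self_eq]
  refine mul_le_mul_of_nonneg_left (Finset.sum_le_sum fun b _ => ?_) hγ.le
  have hwt : (1 : ℝ) ≤ x.toKIdx.cf ^ 2 * ((((θ.ℓ₆ : ℝ) + 1) ^ levV1 x.toKIdx b.src)⁻¹) ^ 2 := by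
    have hcf : x.toKIdx.cf = (((θ.ℓ₆ + 1 : ℕ) : ℝ)) ^ x.toKIdx.k := x.hcfk
    have hL1 : (1 : ℝ) ≤ (θ.ℓ₆ : ℝ) + 1 := by have : (0 : ℝ) ≤ θ.ℓ₆ := Nat.cast_nonneg _; linarith
    have hlev : levV1 x.toKIdx b.src ≤ x.toKIdx.k := levV1_le x.toKIdx b.src
    have hpos : (0 : ℝ) < ((θ.ℓ₆ : ℝ) + 1) ^ levV1 x.toKIdx b.src := pow_pos (lt_of_lt_of_le one_pos hL1) _
    rw [hcf, inv_pow, ← div_eq_mul_inv, one_le_div (pow_pos hpos 2), ← pow_mul, ← pow_mul]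
    push_cast
    exact pow_le_pow_right₀ hL1 (by omega)
  exact le_mul_of_one_le_left (hs_nonneg (A b)) hwt

/-! ## §4 The R-class and `SCMemberY` shapes by name -/

/-- ★★ **THE GAP ON THE CERTIFICATE's R-CLASS** (premise `hRP1`: the R-class at rate `c` lies in print's class (3.35) at rate `c₃₅`): for
`U ∈ (bg9YR … x).Reg335 c α₀` under the guard `c·M·α₀ ≦ a₁`, at section-carrying members above one threshold, `γ·⟨A,A⟩₁ ≤ ⟨A, Δ_a(U)A⟩₁`.
[cite: Balaban1985BackgroundPropagators, Thm 3.11 p.416 with (3.35) p.396] -/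
theorem formGap_deltaAY_of_regYR_section (hN : 1 ≤ N)
    {R₁ R₂ : B9BackgroundsKLevelV1R.RegFamY θ.d₆ θ.ℓ₆ θ.hd' θ.hL' θ.b₀ θ.b₁ Mstar (Matrix (Fin N) (Fin N) ℂ)} {c : ℝ} (hc : 0 < c)
    (hRP1 : ∀ (x : MemberY θ.d₆ θ.ℓ₆ θ.hd' θ.hL' θ.b₀ θ.b₁ Mstar) (α₀ : ℝ)
      (U : (B9BackgroundsKLevelV1R.bg9YR (Matrix (Fin N) (Fin N) ℂ) (specialUnitaryUnits (Fin N)) R₁ R₂ x).Cfg),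
      (B9BackgroundsKLevelV1R.bg9YR (Matrix (Fin N) (Fin N) ℂ) (specialUnitaryUnits (Fin N)) R₁ R₂ x).Reg335 c α₀ U →
        0 ≤ α₀ ∧ (bg9YP (Matrix (Fin N) (Fin N) ℂ) (specialUnitaryUnits (Fin N)) x).Reg335 c35Y α₀ U) :
    ∃ M₁ a₁ γ : ℝ, 0 < M₁ ∧ 0 < a₁ ∧ 0 < γ ∧
    ∀ (x : MemberY θ.d₆ θ.ℓ₆ θ.hd' θ.hL' θ.b₀ θ.b₁ Mstar), Function.Surjective (β x.hN x.D x.hk) → M₁ ≤ (geo9Y x).M →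
      ∀ α₀ : ℝ, 0 < α₀ → c * (geo9Y x).M * α₀ ≤ a₁ →
      ∀ U : (B9BackgroundsKLevelV1R.bg9YR (Matrix (Fin N) (Fin N) ℂ) (specialUnitaryUnits (Fin N)) R₁ R₂ x).Cfg,
        (B9BackgroundsKLevelV1R.bg9YR (Matrix (Fin N) (Fin N) ℂ) (specialUnitaryUnits (Fin N)) R₁ R₂ x).Reg335 c α₀ U →
        ∀ A : FBondY x.toKIdx → Matrix (Fin N) (Fin N) ℂ,
          γ * trIP (fun _ => (1 : ℝ)) A A
            ≤ trIP (fun _ => (1 : ℝ)) A (deltaAY x.toKIdx (parSymY x.toKIdx) (parBY x.toKIdx) (GpY x.toKIdx (parSymY x.toKIdx)) U A) := by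
  obtain ⟨M₁, a₁, γ, hM₁, ha₁, hγ, h⟩ := formGap_deltaAY_of_regYP335_section_one (N := N) θ Mstar hN
  refine ⟨M₁, a₁ * c, γ, hM₁, by positivity, hγ, fun x hsurj hM α₀ hα ha U hU A => ?_⟩
  refine h x hsurj hM α₀ hα ?_ U (hRP1 x α₀ U hU).2 A
  have h1 : c * ((geo9Y x).M * α₀) ≤ c * a₁ := by rw [← mul_assoc, mul_comm c a₁]; exact ha
  exact le_of_mul_le_mul_left h1 hc

/-- ★★★ **THE GAP AT `SCMemberY` BY NAME**: for every section-carrying member `j` (n06-c's carrier `SCMemberY`), `M₁ ≦ M`, `α₀ > 0`, `M·α₀ ≦ a₁`, and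
`U ∈ (bg9YP … j.val).Reg335 c₃₅ α₀`: `γ·⟨A,A⟩₁ ≤ ⟨A, Δ_a(U)A⟩₁` for every `A`. [cite: Balaban1985BackgroundPropagators, Thm 3.11 p.416; Balaban1984PropagatorsII, (2.45) p.231] -/
theorem formGap_deltaAY_at_scMemberY (hN : 1 ≤ N) :
    ∃ M₁ a₁ γ : ℝ, 0 < M₁ ∧ 0 < a₁ ∧ 0 < γ ∧
    ∀ (j : SCMemberY θ.d₆ θ.ℓ₆ θ.hd' θ.hL' θ.b₀ θ.b₁ Mstar), M₁ ≤ (geo9Y j.val).M →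
      ∀ α₀ : ℝ, 0 < α₀ → (geo9Y j.val).M * α₀ ≤ a₁ →
      ∀ U : CfgY (Matrix (Fin N) (Fin N) ℂ) j.val.toKIdx,
        (bg9YP (Matrix (Fin N) (Fin N) ℂ) (specialUnitaryUnits (Fin N)) j.val).Reg335 c35Y α₀ U →
        ∀ A : FBondY j.val.toKIdx → Matrix (Fin N) (Fin N) ℂ,
          γ * trIP (fun _ => (1 : ℝ)) A A
            ≤ trIP (fun _ => (1 : ℝ)) A
                (deltaAY j.val.toKIdx (parSymY j.val.toKIdx) (parBY j.val.toKIdx) (GpY j.val.toKIdx (parSymY j.val.toKIdx)) U A) := by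
  obtain ⟨M₁, a₁, γ, hM₁, ha₁, hγ, h⟩ := formGap_deltaAY_of_regYP335_section_one (N := N) θ Mstar hN
  exact ⟨M₁, a₁, γ, hM₁, ha₁, hγ, fun j hM α₀ hα ha U hU A => h j.val j.surjective_beta hM α₀ hα ha U hU A⟩

end Record

end Literature.MathematicalPhysics.QuantumFieldTheory.Balaban1983to89.B9Thm311FormGapOfRegYP335AtLettersY

end
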